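import Literature.AlgebraicGeometry.Motives.BettiRealizationSummitCompatible
import Literature.AlgebraicGeometry.Motives.SummitCompatible
import HarnessLib

/-!
# The cocycle-level and the cohomology-level summit-compatibility guards agree

Layer `Literature/AlgebraicGeometry/Motives`. Bridge between

* `BettiHodgeData.IsSummitCompatible` (`Motives/BettiRealizationSummitCompatible.lean`), the guard
  phrased with cocycle representatives `ζ`, `[ζ] = B.isoObj X (2p) t`, and the complexified cocycle
  `[ζ ⊗ 1]`, `HodgeTheory.cocycleOfRat` (`HodgeTheory/RationalLattice.lean`) — the form inlined
  verbatim by route `MomentAmplification` and used by name by `AlgebraicClassesPotentiallyTate`; its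
  import cone contains undischarged named facts (through `RationalLattice →
  Motives.BettiCycleClassFiniteProofs`); and
* `BettiHodgeData.IsComparisonCompatible` (`Motives/SummitCompatible.lean`), the same guard phrased
  on cohomology classes through `B.toComplexBetti X i = ringChange (ℚ ↪ ℂ) ∘ B.isoObj X i`, whose
  import cone is free of named facts.

The only point is `[ζ ⊗ 1] = ι [ζ]` (`π_cocycleOfRat_eq_ringChange`): the two change-of-coefficient
constructions of the tree, `HodgeTheory.cocycleOfRat` (values `q ↦ (q : ℂ)`) and
`cocyclesRingChange (algebraMap ℚ ℂ)` (values `q ↦ algebraMap ℚ ℂ q`), agree (`eq_ratCast`), and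
`ringChange` is computed on representatives (`singularCohomology.ringChange_π`; Hatcher 2002, §3.1
p. 198). Hence `BettiHodgeData.isSummitCompatible_iff_isComparisonCompatible`, by which every result
about one guard (the transfer theorems of either file, `AlgebraicClassesPotentiallyTate`, route
statements) applies to the other. This file necessarily imports both cones; routes that want the
clean cone import `Motives/SummitCompatible.lean` only.

## References

* A. Hatcher, *Algebraic Topology* (2002), §3.1 p. 198 (change of coefficients).
* P. Deligne, *The Hodge conjecture*, Clay Mathematics Institute problem description (2000), §1.
-/

noncomputable section

open CategoryTheory

universe u

namespace Literature.AlgebraicGeometry.Motives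

open Literature.AlgebraicTopology.SingularHomology

/-- **`[ζ ⊗ 1] = ι [ζ]`**: the class of the complexified cocycle `HodgeTheory.cocycleOfRat Y k ζ` of a
`ℚ`-cocycle `ζ` is the change of coefficients `ι = singularCohomology.ringChange (ℚ ↪ ℂ)` of the
class of `ζ` (both are "compose the values with `ℚ ↪ ℂ`", Hatcher 2002, §3.1 p. 198; the two
spellings `(q : ℂ)` and `algebraMap ℚ ℂ q` of the inclusion agree by `eq_ratCast`).
[cite: HatcherAT2002, §3.1 p. 198] -/
theorem π_cocycleOfRat_eq_ringChange {Y : Type u} [TopologicalSpace Y] {k : ℕ}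
    (ζ : singularCochainComplex.cocycles ℚ ℚ Y k) :
    singularCohomology.π ℂ ℂ Y k (HodgeTheory.cocycleOfRat Y k ζ) =
      singularCohomology.ringChange (algebraMap ℚ ℂ) Y k (singularCohomology.π ℚ ℚ Y k ζ) := by
  rw [singularCohomology.ringChange_π]
  exact congrArg _ (coFn_injective (by
    rw [coFn_cocyclesRingChange, coFn_eq, HodgeTheory.iCocycles_cocycleOfRat]
    funext σ
    rw [HodgeTheory.ofRatCochain_apply, Function.comp_apply, eq_ratCast]
    rfl))

namespace BettiHodgeData

/-- The complexified comparison of `t ∈ Hⁱ_B(X)` is the class `[ζ ⊗ 1]` of the complexification of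
ANY cocycle representative `ζ` of `B.isoObj X i t`. [cite: HatcherAT2002, §3.1 p. 198] -/
theorem toComplexBetti_eq_π_cocycleOfRat {k : Type} [Field k] [Algebra k ℂ] (B : BettiHodgeData k)
    {X : SchemeOver k} {i : ℕ} {t : B.W.obj X i}
    {ζ : singularCochainComplex.cocycles ℚ ℚ (ComplexPoints X) i}
    (hζ : singularCohomology.π ℚ ℚ (ComplexPoints X) i ζ = B.isoObj X i t) :
    B.toComplexBetti X i t =
      singularCohomology.π ℂ ℂ (ComplexPoints X) i (HodgeTheory.cocycleOfRat (ComplexPoints X) i ζ) := by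
  rw [toComplexBetti_apply, ← hζ, π_cocycleOfRat_eq_ringChange]

/-- The set of complexified `B`-algebraic classes written with cocycle representatives (clause (b)
of `IsSummitCompatible`) is the image of `ℚ · Aᵖ_B(X)` under `B.toComplexBetti X (2p)` (clause (b)
of `IsComparisonCompatible`). [folklore] -/
theorem setOf_π_cocycleOfRat_eq_image (B : BettiHodgeData ℂ) (X : SchemeOver ℂ) (p : ℕ) :
    {c | ∃ t ∈ B.W.algebraicClasses X p,
        ∃ ζ : singularCochainComplex.cocycles ℚ ℚ (ComplexPoints X) (2 * p),
          singularCohomology.π ℚ ℚ (ComplexPoints X) (2 * p) ζ = B.isoObj X (2 * p) t ∧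
            c = singularCohomology.π ℂ ℂ (ComplexPoints X) (2 * p)
              (HodgeTheory.cocycleOfRat (ComplexPoints X) (2 * p) ζ)} =
      B.toComplexBetti X (2 * p) '' (B.W.algebraicClasses X p : Set (B.W.obj X (2 * p))) := by
  ext c
  constructor
  · rintro ⟨t, ht, ζ, hζ, rfl⟩
    exact ⟨t, ht, B.toComplexBetti_eq_π_cocycleOfRat hζ⟩
  · rintro ⟨t, ht, rfl⟩
    obtain ⟨ζ, hζ⟩ := B.exists_π_eq_isoObj X (2 * p) t
    exact ⟨t, ht, ζ, hζ, B.toComplexBetti_eq_π_cocycleOfRat hζ⟩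

variable {B : BettiHodgeData ℂ}

/-- **The cocycle-level and the cohomology-level guards agree**:
`B.IsSummitCompatible ↔ B.IsComparisonCompatible`. Clause by clause for each smooth projective `X`
and each `p`: (a) every `t` has a representative `ζ` (`exists_π_eq_isoObj`) and for every
representative `[ζ ⊗ 1] = B.toComplexBetti X (2p) t` (`toComplexBetti_eq_π_cocycleOfRat`);
(b) the two generating sets coincide (`setOf_π_cocycleOfRat_eq_image`); (c) is literally the same.
[cite: Deligne2000, §1] [cite: HatcherAT2002, §3.1 p. 198] -/
theorem isSummitCompatible_iff_isComparisonCompatible :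
    B.IsSummitCompatible ↔ B.IsComparisonCompatible := by
  refine forall_congr' fun n ↦ forall_congr' fun X ↦ forall_congr' fun hX ↦
    forall_congr' fun p ↦ and_congr (forall_congr' fun t ↦ ?_) (and_congr ?_ Iff.rfl)
  · constructor
    · intro h
      obtain ⟨ζ, hζ⟩ := B.exists_π_eq_isoObj X (2 * p) t
      rw [B.toComplexBetti_eq_π_cocycleOfRat hζ]
      exact h ζ hζ
    · intro h ζ hζ
      rwa [B.toComplexBetti_eq_π_cocycleOfRat hζ] at h
  · rw [B.setOf_π_cocycleOfRat_eq_image X p]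

/-- The cocycle-level guard, unfolded to the change-of-coefficients form requested by the routes:
`B.IsSummitCompatible ↔ ∀ X p, (∀ t, t ∈ Hdgᵖ_B(X) ↔ ι(isoObj t) is of type (p,p)) ∧
ℂ · ι(isoObj(ℚ · Aᵖ_B(X))) = algebraicClasses X p ∧ Nonempty (HodgeModel n X)`, with
`ι = singularCohomology.ringChange (algebraMap ℚ ℂ)`. [cite: Deligne2000, §1] -/
theorem isSummitCompatible_iff_ringChange :
    B.IsSummitCompatible ↔
      ∀ ⦃n : ℕ⦄ ⦃X : SchemeOver ℂ⦄ (hX : IsSmoothProjective n X) (p : ℕ),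
        (∀ t : B.W.obj X (2 * p),
            t ∈ (B.hodge hX (2 * p)).hodgeClasses (p : ℤ) ↔
              HodgeTheory.IsOfHodgeType n X (2 * p) p p
                (singularCohomology.ringChange (algebraMap ℚ ℂ) (ComplexPoints X) (2 * p)
                  (B.isoObj X (2 * p) t))) ∧
          Submodule.span ℂ ((fun t ↦ singularCohomology.ringChange (algebraMap ℚ ℂ)
              (ComplexPoints X) (2 * p) (B.isoObj X (2 * p) t)) ''
              (B.W.algebraicClasses X p : Set (B.W.obj X (2 * p)))) =
            HodgeTheory.algebraicClasses X p ∧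
          Nonempty (HodgeTheory.HodgeModel n X) :=
  isSummitCompatible_iff_isComparisonCompatible.trans isComparisonCompatible_iff

end BettiHodgeData

end Literature.AlgebraicGeometry.Motives

end
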